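import Mathlib
import HarnessLib
import Summits.AtomisticToContinuum.Crystallization.Theorems.FrustratedLawDichotomyAperiodicFrustratedLawGapErgodicKernelAverage

/-!
# Ergodic reduction for the crux `AperiodicFrustratedLawGap` — the pointwise re-rooting average in `L²`

Route `FrustratedLawDichotomy`, crux `AperiodicFrustratedLawGap` (item `stmt-AtomisticToContinuum-27623`),
registered stub `stub_ergodicReduction` (skeleton `dd3251ad731e`); eleventh brick of step D5 (`hErg`; evidence
`D5-PLAN.md`, S1).  The POINTWISE re-rooting average `(A f)(S) = ∫ f((Θ(S,y)).1) dK(S)(y)` (`K` the re-rooting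
kernel of `…ErgodicKernelAverage`) of a bounded measurable real function is bounded and measurable, fixes
exactly invariant functions, and its `L²(ν)`-class is the image of `[f]` under the contraction `P = E† U E`
(`…ErgodicOperatorFix`): `P [f] = [A f]`.  Hence the Cesàro averages of `P` are the classes of the pointwise
Cesàro averages — the bridge between Mathlib's von Neumann theorem and the measure-independent pointwise
objects of steps S2–S5.

* `stronglyMeasurable_rerootAverage`, `norm_rerootAverage_le` — measurability and the bound `‖A f‖ ≤ C`;
* `rerootAverage_eq_self_of_invariant` — `A h = h` for exactly re-rooting-invariant `h`;
* `Lp_eq_of_forall_inner_toLp_eq` — two vectors of `L²(ν)` with the same inner products against all `[g]` agree;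
* `exists_rerootOperator_toLp` — the operator `P` with `P [f] = [A f]` for bounded measurable `f` (and the
  fixed-point property of `…ErgodicOperatorFix`).

`[folklore]`.
-/

noncomputable section

namespace Summit.AtomisticToContinuum.Crystallization.Theorems.FrustratedLawDichotomyErgodicReduction

open MeasureTheory Set Filter ProbabilityTheory
open scoped ENNReal Classical InnerProductSpace
open Literature.Probability.Process (LocalConfig)
open Literature.Probability.Process.LocalConfig (RootedHardCoreConfig toMeasure_def measurable_toMeasure)
open Summit.AtomisticToContinuum.Crystallization.Theorems.BenjaminiSchrammLimit (isSFiniteKernel_toMeasure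
  measurable_reroot)

variable {δ : ℝ}

/-- **The pointwise re-rooting average of a measurable function is (strongly) measurable** (`δ > 0`). [folklore] -/
theorem stronglyMeasurable_rerootAverage [Fact (0 < δ)] {w : EuclideanSpace ℝ (Fin 3) → ℝ≥0∞} (hw : Measurable w)
    (hw1 : ∀ S : RootedHardCoreConfig (EuclideanSpace ℝ (Fin 3)) δ,
      ∫⁻ y, w y ∂((S.1 : LocalConfig (EuclideanSpace ℝ (Fin 3))).toMeasure) ≤ 1)
    {f : RootedHardCoreConfig (EuclideanSpace ℝ (Fin 3)) δ → ℝ} (hf : Measurable f) :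
    StronglyMeasurable (fun S : RootedHardCoreConfig (EuclideanSpace ℝ (Fin 3)) δ => ∫ y, f ((fun p : RootedHardCoreConfig (EuclideanSpace ℝ (Fin 3)) δ × EuclideanSpace ℝ (Fin 3) =>
        ((if h : p.2 ∈ ((p.1.1 : LocalConfig (EuclideanSpace ℝ (Fin 3))) : Set (EuclideanSpace ℝ (Fin 3)))
          then p.1.reroot p.2 h else p.1 : RootedHardCoreConfig (EuclideanSpace ℝ (Fin 3)) δ), -p.2)) (S, y)).1 ∂((haveI := isSFiniteKernel_toMeasure (E := EuclideanSpace ℝ (Fin 3)) (δ := δ)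
          Kernel.withDensity (⟨fun S : RootedHardCoreConfig (EuclideanSpace ℝ (Fin 3)) δ =>
        (S.1 : LocalConfig (EuclideanSpace ℝ (Fin 3))).toMeasure,
        measurable_toMeasure (Fact.out : 0 < δ)⟩ :
        Kernel (RootedHardCoreConfig (EuclideanSpace ℝ (Fin 3)) δ) (EuclideanSpace ℝ (Fin 3)))
          (fun (S : RootedHardCoreConfig (EuclideanSpace ℝ (Fin 3)) δ) (y : EuclideanSpace ℝ (Fin 3)) =>
        w y + (1 - ∫⁻ z, w z ∂((S.1 : LocalConfig (EuclideanSpace ℝ (Fin 3))).toMeasure)) *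
          ({(0 : EuclideanSpace ℝ (Fin 3))} : Set (EuclideanSpace ℝ (Fin 3))).indicator (fun _ => (1 : ℝ≥0∞)) y)) S)) := by
  haveI := isSFiniteKernel_toMeasure (E := EuclideanSpace ℝ (Fin 3)) (δ := δ)
  haveI := isMarkovKernel_rerootKernel (δ := δ) hw hw1
  have hδ : 0 < δ := Fact.out
  have hΘ : Measurable (fun p : RootedHardCoreConfig (EuclideanSpace ℝ (Fin 3)) δ × EuclideanSpace ℝ (Fin 3) =>
        ((if h : p.2 ∈ ((p.1.1 : LocalConfig (EuclideanSpace ℝ (Fin 3))) : Set (EuclideanSpace ℝ (Fin 3)))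
          then p.1.reroot p.2 h else p.1 : RootedHardCoreConfig (EuclideanSpace ℝ (Fin 3)) δ), -p.2)) := measurable_reroot hδ
  exact (hf.comp hΘ.fst).stronglyMeasurable.integral_kernel_prod_right'

/-- **The pointwise re-rooting average of a bounded function is bounded by the same constant** (the kernel
is Markov). [folklore] -/
theorem norm_rerootAverage_le [Fact (0 < δ)] {w : EuclideanSpace ℝ (Fin 3) → ℝ≥0∞} (hw : Measurable w)
    (hw1 : ∀ S : RootedHardCoreConfig (EuclideanSpace ℝ (Fin 3)) δ,
      ∫⁻ y, w y ∂((S.1 : LocalConfig (EuclideanSpace ℝ (Fin 3))).toMeasure) ≤ 1)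
    {f : RootedHardCoreConfig (EuclideanSpace ℝ (Fin 3)) δ → ℝ} {C : ℝ} (hC : ∀ S, ‖f S‖ ≤ C) (S : RootedHardCoreConfig (EuclideanSpace ℝ (Fin 3)) δ) :
    ‖(fun S : RootedHardCoreConfig (EuclideanSpace ℝ (Fin 3)) δ => ∫ y, f ((fun p : RootedHardCoreConfig (EuclideanSpace ℝ (Fin 3)) δ × EuclideanSpace ℝ (Fin 3) =>
        ((if h : p.2 ∈ ((p.1.1 : LocalConfig (EuclideanSpace ℝ (Fin 3))) : Set (EuclideanSpace ℝ (Fin 3)))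
          then p.1.reroot p.2 h else p.1 : RootedHardCoreConfig (EuclideanSpace ℝ (Fin 3)) δ), -p.2)) (S, y)).1 ∂((haveI := isSFiniteKernel_toMeasure (E := EuclideanSpace ℝ (Fin 3)) (δ := δ)
          Kernel.withDensity (⟨fun S : RootedHardCoreConfig (EuclideanSpace ℝ (Fin 3)) δ =>
        (S.1 : LocalConfig (EuclideanSpace ℝ (Fin 3))).toMeasure,
        measurable_toMeasure (Fact.out : 0 < δ)⟩ :
        Kernel (RootedHardCoreConfig (EuclideanSpace ℝ (Fin 3)) δ) (EuclideanSpace ℝ (Fin 3)))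
          (fun (S : RootedHardCoreConfig (EuclideanSpace ℝ (Fin 3)) δ) (y : EuclideanSpace ℝ (Fin 3)) =>
        w y + (1 - ∫⁻ z, w z ∂((S.1 : LocalConfig (EuclideanSpace ℝ (Fin 3))).toMeasure)) *
          ({(0 : EuclideanSpace ℝ (Fin 3))} : Set (EuclideanSpace ℝ (Fin 3))).indicator (fun _ => (1 : ℝ≥0∞)) y)) S)) S‖ ≤ C := by
  haveI := isSFiniteKernel_toMeasure (E := EuclideanSpace ℝ (Fin 3)) (δ := δ)
  haveI := isMarkovKernel_rerootKernel (δ := δ) hw hw1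
  refine (norm_integral_le_of_norm_le_const (Eventually.of_forall fun y => hC _)).trans ?_
  rw [probReal_univ, mul_one]

/-- **Exactly invariant functions are fixed by the pointwise average**: if `h(S − y) = h(S)` for all `S` and
all `y ∈ S`, then `(A h)(S) = h(S)` for every configuration `S` (the kernel `K(S)` is carried by the points of
`S` and is a probability measure). [folklore] -/
theorem rerootAverage_eq_self_of_invariant [Fact (0 < δ)] {w : EuclideanSpace ℝ (Fin 3) → ℝ≥0∞} (hw : Measurable w)
    (hw1 : ∀ S : RootedHardCoreConfig (EuclideanSpace ℝ (Fin 3)) δ,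
      ∫⁻ y, w y ∂((S.1 : LocalConfig (EuclideanSpace ℝ (Fin 3))).toMeasure) ≤ 1)
    {f : RootedHardCoreConfig (EuclideanSpace ℝ (Fin 3)) δ → ℝ}
    (hinv : ∀ (S : RootedHardCoreConfig (EuclideanSpace ℝ (Fin 3)) δ) (y : EuclideanSpace ℝ (Fin 3))
      (hy : y ∈ ((S.1 : LocalConfig (EuclideanSpace ℝ (Fin 3))) : Set (EuclideanSpace ℝ (Fin 3)))), f (S.reroot y hy) = f S)
    (S : RootedHardCoreConfig (EuclideanSpace ℝ (Fin 3)) δ) :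
    (fun S : RootedHardCoreConfig (EuclideanSpace ℝ (Fin 3)) δ => ∫ y, f ((fun p : RootedHardCoreConfig (EuclideanSpace ℝ (Fin 3)) δ × EuclideanSpace ℝ (Fin 3) =>
        ((if h : p.2 ∈ ((p.1.1 : LocalConfig (EuclideanSpace ℝ (Fin 3))) : Set (EuclideanSpace ℝ (Fin 3)))
          then p.1.reroot p.2 h else p.1 : RootedHardCoreConfig (EuclideanSpace ℝ (Fin 3)) δ), -p.2)) (S, y)).1 ∂((haveI := isSFiniteKernel_toMeasure (E := EuclideanSpace ℝ (Fin 3)) (δ := δ)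
          Kernel.withDensity (⟨fun S : RootedHardCoreConfig (EuclideanSpace ℝ (Fin 3)) δ =>
        (S.1 : LocalConfig (EuclideanSpace ℝ (Fin 3))).toMeasure,
        measurable_toMeasure (Fact.out : 0 < δ)⟩ :
        Kernel (RootedHardCoreConfig (EuclideanSpace ℝ (Fin 3)) δ) (EuclideanSpace ℝ (Fin 3)))
          (fun (S : RootedHardCoreConfig (EuclideanSpace ℝ (Fin 3)) δ) (y : EuclideanSpace ℝ (Fin 3)) =>
        w y + (1 - ∫⁻ z, w z ∂((S.1 : LocalConfig (EuclideanSpace ℝ (Fin 3))).toMeasure)) *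
          ({(0 : EuclideanSpace ℝ (Fin 3))} : Set (EuclideanSpace ℝ (Fin 3))).indicator (fun _ => (1 : ℝ≥0∞)) y)) S)) S = f S := by
  haveI := isSFiniteKernel_toMeasure (E := EuclideanSpace ℝ (Fin 3)) (δ := δ)
  haveI := isMarkovKernel_rerootKernel (δ := δ) hw hw1
  have hδ : 0 < δ := Fact.out
  have hae : ∀ᵐ y ∂((haveI := isSFiniteKernel_toMeasure (E := EuclideanSpace ℝ (Fin 3)) (δ := δ)
          Kernel.withDensity (⟨fun S : RootedHardCoreConfig (EuclideanSpace ℝ (Fin 3)) δ =>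
        (S.1 : LocalConfig (EuclideanSpace ℝ (Fin 3))).toMeasure,
        measurable_toMeasure (Fact.out : 0 < δ)⟩ :
        Kernel (RootedHardCoreConfig (EuclideanSpace ℝ (Fin 3)) δ) (EuclideanSpace ℝ (Fin 3)))
          (fun (S : RootedHardCoreConfig (EuclideanSpace ℝ (Fin 3)) δ) (y : EuclideanSpace ℝ (Fin 3)) =>
        w y + (1 - ∫⁻ z, w z ∂((S.1 : LocalConfig (EuclideanSpace ℝ (Fin 3))).toMeasure)) *
          ({(0 : EuclideanSpace ℝ (Fin 3))} : Set (EuclideanSpace ℝ (Fin 3))).indicator (fun _ => (1 : ℝ≥0∞)) y)) S), f ((fun p : RootedHardCoreConfig (EuclideanSpace ℝ (Fin 3)) δ × EuclideanSpace ℝ (Fin 3) =>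
        ((if h : p.2 ∈ ((p.1.1 : LocalConfig (EuclideanSpace ℝ (Fin 3))) : Set (EuclideanSpace ℝ (Fin 3)))
          then p.1.reroot p.2 h else p.1 : RootedHardCoreConfig (EuclideanSpace ℝ (Fin 3)) δ), -p.2)) (S, y)).1 = f S := by
    have hac : ((haveI := isSFiniteKernel_toMeasure (E := EuclideanSpace ℝ (Fin 3)) (δ := δ)
          Kernel.withDensity (⟨fun S : RootedHardCoreConfig (EuclideanSpace ℝ (Fin 3)) δ =>
        (S.1 : LocalConfig (EuclideanSpace ℝ (Fin 3))).toMeasure,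
        measurable_toMeasure (Fact.out : 0 < δ)⟩ :
        Kernel (RootedHardCoreConfig (EuclideanSpace ℝ (Fin 3)) δ) (EuclideanSpace ℝ (Fin 3)))
          (fun (S : RootedHardCoreConfig (EuclideanSpace ℝ (Fin 3)) δ) (y : EuclideanSpace ℝ (Fin 3)) =>
        w y + (1 - ∫⁻ z, w z ∂((S.1 : LocalConfig (EuclideanSpace ℝ (Fin 3))).toMeasure)) *
          ({(0 : EuclideanSpace ℝ (Fin 3))} : Set (EuclideanSpace ℝ (Fin 3))).indicator (fun _ => (1 : ℝ≥0∞)) y)) S) ≪ ((S.1 : LocalConfig (EuclideanSpace ℝ (Fin 3))).toMeasure) := by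
      rw [Kernel.withDensity_apply _ (measurable_uncurry_campbellWeight hw)]
      exact withDensity_absolutelyContinuous _ _
    refine hac.ae_le ?_
    rw [toMeasure_def]
    filter_upwards [ae_restrict_mem (RootedHardCoreConfig.isClosed_coe hδ S).measurableSet] with y hy
    simp only [dif_pos hy]
    exact hinv S y hy
  show ∫ y, f ((fun p : RootedHardCoreConfig (EuclideanSpace ℝ (Fin 3)) δ × EuclideanSpace ℝ (Fin 3) =>
        ((if h : p.2 ∈ ((p.1.1 : LocalConfig (EuclideanSpace ℝ (Fin 3))) : Set (EuclideanSpace ℝ (Fin 3)))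
          then p.1.reroot p.2 h else p.1 : RootedHardCoreConfig (EuclideanSpace ℝ (Fin 3)) δ), -p.2)) (S, y)).1 ∂((haveI := isSFiniteKernel_toMeasure (E := EuclideanSpace ℝ (Fin 3)) (δ := δ)
          Kernel.withDensity (⟨fun S : RootedHardCoreConfig (EuclideanSpace ℝ (Fin 3)) δ =>
        (S.1 : LocalConfig (EuclideanSpace ℝ (Fin 3))).toMeasure,
        measurable_toMeasure (Fact.out : 0 < δ)⟩ :
        Kernel (RootedHardCoreConfig (EuclideanSpace ℝ (Fin 3)) δ) (EuclideanSpace ℝ (Fin 3)))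
          (fun (S : RootedHardCoreConfig (EuclideanSpace ℝ (Fin 3)) δ) (y : EuclideanSpace ℝ (Fin 3)) =>
        w y + (1 - ∫⁻ z, w z ∂((S.1 : LocalConfig (EuclideanSpace ℝ (Fin 3))).toMeasure)) *
          ({(0 : EuclideanSpace ℝ (Fin 3))} : Set (EuclideanSpace ℝ (Fin 3))).indicator (fun _ => (1 : ℝ≥0∞)) y)) S) = f S
  rw [integral_congr_ae hae, integral_const, probReal_univ, one_smul]

/-- Two vectors of `L²(ν)` with the same inner products against the classes of all square-integrable functions
are equal. [folklore] -/
theorem Lp_eq_of_forall_inner_toLp_eq {α : Type*} [MeasurableSpace α] {ν : Measure α} {a b : Lp ℝ 2 ν}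
    (h : ∀ (g : α → ℝ) (hg : MemLp g 2 ν), ⟪hg.toLp g, a⟫_ℝ = ⟪hg.toLp g, b⟫_ℝ) : a = b := by
  refine ext_inner_left ℝ fun v => ?_
  have hv := h v (Lp.memLp v)
  rwa [Lp.toLp_coeFn v (Lp.memLp v)] at hv

/-- **`P [f] = [A f]`: the re-rooting operator acts on classes of bounded measurable functions by the pointwise
re-rooting average** (`δ > 0`; `ν` a probability law with Campbell measure invariant under re-rooting; weight
measurable, even, of mass `≤ 1`).  Packaged with the operator of `…ErgodicOperatorFix` / `…ErgodicKernelAverage`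
(existential, no definition): `‖P‖ ≤ 1`, fixed points are invariant along `π`-a.e. edge, and
`P (toLp f) = toLp (A f)` for every bounded measurable `f` (with the `MemLp` witness of `A f` supplied by
boundedness). [folklore] -/
theorem exists_rerootOperator_toLp [Fact (0 < δ)]
    {ν : Measure (RootedHardCoreConfig (EuclideanSpace ℝ (Fin 3)) δ)} [IsProbabilityMeasure ν]
    (hinv : haveI := isSFiniteKernel_toMeasure (E := EuclideanSpace ℝ (Fin 3)) (δ := δ)
      (ν ⊗ₘ (⟨fun S : RootedHardCoreConfig (EuclideanSpace ℝ (Fin 3)) δ =>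
        (S.1 : LocalConfig (EuclideanSpace ℝ (Fin 3))).toMeasure,
        measurable_toMeasure (Fact.out : 0 < δ)⟩ :
        Kernel (RootedHardCoreConfig (EuclideanSpace ℝ (Fin 3)) δ) (EuclideanSpace ℝ (Fin 3)))).map
      (fun p : RootedHardCoreConfig (EuclideanSpace ℝ (Fin 3)) δ × EuclideanSpace ℝ (Fin 3) =>
        ((if h : p.2 ∈ ((p.1.1 : LocalConfig (EuclideanSpace ℝ (Fin 3))) : Set (EuclideanSpace ℝ (Fin 3)))
          then p.1.reroot p.2 h else p.1 : RootedHardCoreConfig (EuclideanSpace ℝ (Fin 3)) δ), -p.2)) =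
      ν ⊗ₘ (⟨fun S : RootedHardCoreConfig (EuclideanSpace ℝ (Fin 3)) δ =>
        (S.1 : LocalConfig (EuclideanSpace ℝ (Fin 3))).toMeasure,
        measurable_toMeasure (Fact.out : 0 < δ)⟩ :
        Kernel (RootedHardCoreConfig (EuclideanSpace ℝ (Fin 3)) δ) (EuclideanSpace ℝ (Fin 3))))
    {w : EuclideanSpace ℝ (Fin 3) → ℝ≥0∞} (hw : Measurable w) (hws : ∀ y, w (-y) = w y)
    (hw1 : ∀ S : RootedHardCoreConfig (EuclideanSpace ℝ (Fin 3)) δ,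
      ∫⁻ y, w y ∂((S.1 : LocalConfig (EuclideanSpace ℝ (Fin 3))).toMeasure) ≤ 1) :
    ∃ P : Lp ℝ 2 ν →L[ℝ] Lp ℝ 2 ν, ‖P‖ ≤ 1 ∧
      (∀ (h : RootedHardCoreConfig (EuclideanSpace ℝ (Fin 3)) δ → ℝ) (hh : MemLp h 2 ν), P (hh.toLp h) = hh.toLp h →
        ∀ᵐ q ∂(haveI := isSFiniteKernel_toMeasure (E := EuclideanSpace ℝ (Fin 3)) (δ := δ)
      ((ν ⊗ₘ (⟨fun S : RootedHardCoreConfig (EuclideanSpace ℝ (Fin 3)) δ =>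
        (S.1 : LocalConfig (EuclideanSpace ℝ (Fin 3))).toMeasure,
        measurable_toMeasure (Fact.out : 0 < δ)⟩ :
        Kernel (RootedHardCoreConfig (EuclideanSpace ℝ (Fin 3)) δ) (EuclideanSpace ℝ (Fin 3)))).withDensity
      (fun p : RootedHardCoreConfig (EuclideanSpace ℝ (Fin 3)) δ × EuclideanSpace ℝ (Fin 3) =>
        w p.2 + (1 - ∫⁻ z, w z ∂((p.1.1 : LocalConfig (EuclideanSpace ℝ (Fin 3))).toMeasure)) *
          ({(0 : EuclideanSpace ℝ (Fin 3))} : Set (EuclideanSpace ℝ (Fin 3))).indicator (fun _ => (1 : ℝ≥0∞)) p.2))),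
          h ((fun p : RootedHardCoreConfig (EuclideanSpace ℝ (Fin 3)) δ × EuclideanSpace ℝ (Fin 3) =>
        ((if h : p.2 ∈ ((p.1.1 : LocalConfig (EuclideanSpace ℝ (Fin 3))) : Set (EuclideanSpace ℝ (Fin 3)))
          then p.1.reroot p.2 h else p.1 : RootedHardCoreConfig (EuclideanSpace ℝ (Fin 3)) δ), -p.2)) q).1 = h q.1) ∧
      ∀ (f : RootedHardCoreConfig (EuclideanSpace ℝ (Fin 3)) δ → ℝ) (hf : Measurable f) (C : ℝ) (hC : ∀ S, ‖f S‖ ≤ C) (hf2 : MemLp f 2 ν),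
        P (hf2.toLp f) =
          (MemLp.of_bound (stronglyMeasurable_rerootAverage hw hw1 hf).aestronglyMeasurable C
            (Eventually.of_forall (norm_rerootAverage_le hw hw1 hC)) : MemLp (fun S : RootedHardCoreConfig (EuclideanSpace ℝ (Fin 3)) δ => ∫ y, f ((fun p : RootedHardCoreConfig (EuclideanSpace ℝ (Fin 3)) δ × EuclideanSpace ℝ (Fin 3) =>
        ((if h : p.2 ∈ ((p.1.1 : LocalConfig (EuclideanSpace ℝ (Fin 3))) : Set (EuclideanSpace ℝ (Fin 3)))
          then p.1.reroot p.2 h else p.1 : RootedHardCoreConfig (EuclideanSpace ℝ (Fin 3)) δ), -p.2)) (S, y)).1 ∂((haveI := isSFiniteKernel_toMeasure (E := EuclideanSpace ℝ (Fin 3)) (δ := δ)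
          Kernel.withDensity (⟨fun S : RootedHardCoreConfig (EuclideanSpace ℝ (Fin 3)) δ =>
        (S.1 : LocalConfig (EuclideanSpace ℝ (Fin 3))).toMeasure,
        measurable_toMeasure (Fact.out : 0 < δ)⟩ :
        Kernel (RootedHardCoreConfig (EuclideanSpace ℝ (Fin 3)) δ) (EuclideanSpace ℝ (Fin 3)))
          (fun (S : RootedHardCoreConfig (EuclideanSpace ℝ (Fin 3)) δ) (y : EuclideanSpace ℝ (Fin 3)) =>
        w y + (1 - ∫⁻ z, w z ∂((S.1 : LocalConfig (EuclideanSpace ℝ (Fin 3))).toMeasure)) *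
          ({(0 : EuclideanSpace ℝ (Fin 3))} : Set (EuclideanSpace ℝ (Fin 3))).indicator (fun _ => (1 : ℝ≥0∞)) y)) S)) 2 ν).toLp
          (fun S : RootedHardCoreConfig (EuclideanSpace ℝ (Fin 3)) δ => ∫ y, f ((fun p : RootedHardCoreConfig (EuclideanSpace ℝ (Fin 3)) δ × EuclideanSpace ℝ (Fin 3) =>
        ((if h : p.2 ∈ ((p.1.1 : LocalConfig (EuclideanSpace ℝ (Fin 3))) : Set (EuclideanSpace ℝ (Fin 3)))
          then p.1.reroot p.2 h else p.1 : RootedHardCoreConfig (EuclideanSpace ℝ (Fin 3)) δ), -p.2)) (S, y)).1 ∂((haveI := isSFiniteKernel_toMeasure (E := EuclideanSpace ℝ (Fin 3)) (δ := δ)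
          Kernel.withDensity (⟨fun S : RootedHardCoreConfig (EuclideanSpace ℝ (Fin 3)) δ =>
        (S.1 : LocalConfig (EuclideanSpace ℝ (Fin 3))).toMeasure,
        measurable_toMeasure (Fact.out : 0 < δ)⟩ :
        Kernel (RootedHardCoreConfig (EuclideanSpace ℝ (Fin 3)) δ) (EuclideanSpace ℝ (Fin 3)))
          (fun (S : RootedHardCoreConfig (EuclideanSpace ℝ (Fin 3)) δ) (y : EuclideanSpace ℝ (Fin 3)) =>
        w y + (1 - ∫⁻ z, w z ∂((S.1 : LocalConfig (EuclideanSpace ℝ (Fin 3))).toMeasure)) *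
          ({(0 : EuclideanSpace ℝ (Fin 3))} : Set (EuclideanSpace ℝ (Fin 3))).indicator (fun _ => (1 : ℝ≥0∞)) y)) S)) := by
  obtain ⟨P, hP1, hfix, hme⟩ := exists_rerootOperator_pt (δ := δ) hinv hw hws hw1
  refine ⟨P, hP1, hfix, fun f hf C hC hf2 => ?_⟩
  refine Lp_eq_of_forall_inner_toLp_eq fun g hg => ?_
  rw [hme f g hf2 hg hf ⟨C, hC⟩, MeasureTheory.L2.inner_def]
  refine integral_congr_ae ?_
  have h1 := hg.coeFn_toLp
  have h2 := (MemLp.of_bound (stronglyMeasurable_rerootAverage hw hw1 hf).aestronglyMeasurable C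
    (Eventually.of_forall (norm_rerootAverage_le hw hw1 hC)) : MemLp (fun S : RootedHardCoreConfig (EuclideanSpace ℝ (Fin 3)) δ => ∫ y, f ((fun p : RootedHardCoreConfig (EuclideanSpace ℝ (Fin 3)) δ × EuclideanSpace ℝ (Fin 3) =>
        ((if h : p.2 ∈ ((p.1.1 : LocalConfig (EuclideanSpace ℝ (Fin 3))) : Set (EuclideanSpace ℝ (Fin 3)))
          then p.1.reroot p.2 h else p.1 : RootedHardCoreConfig (EuclideanSpace ℝ (Fin 3)) δ), -p.2)) (S, y)).1 ∂((haveI := isSFiniteKernel_toMeasure (E := EuclideanSpace ℝ (Fin 3)) (δ := δ)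
          Kernel.withDensity (⟨fun S : RootedHardCoreConfig (EuclideanSpace ℝ (Fin 3)) δ =>
        (S.1 : LocalConfig (EuclideanSpace ℝ (Fin 3))).toMeasure,
        measurable_toMeasure (Fact.out : 0 < δ)⟩ :
        Kernel (RootedHardCoreConfig (EuclideanSpace ℝ (Fin 3)) δ) (EuclideanSpace ℝ (Fin 3)))
          (fun (S : RootedHardCoreConfig (EuclideanSpace ℝ (Fin 3)) δ) (y : EuclideanSpace ℝ (Fin 3)) =>
        w y + (1 - ∫⁻ z, w z ∂((S.1 : LocalConfig (EuclideanSpace ℝ (Fin 3))).toMeasure)) *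
          ({(0 : EuclideanSpace ℝ (Fin 3))} : Set (EuclideanSpace ℝ (Fin 3))).indicator (fun _ => (1 : ℝ≥0∞)) y)) S)) 2 ν).coeFn_toLp
  filter_upwards [h1, h2] with S hS1 hS2
  rw [hS1, hS2]
  simp only [RCLike.inner_apply, conj_trivial]
  ring

end Summit.AtomisticToContinuum.Crystallization.Theorems.FrustratedLawDichotomyErgodicReduction

end
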